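import Summits.BirchSwinnertonDyer.BirchSwinnertonDyer.Theses.TameQuarticSolvent
import HarnessLib

/-!
# Route `TameQuarticSolvent` — the ASSEMBLY item (stmt-BirchSwinnertonDyer-21394) closed by name

HONEST FRAMING. This file proves the route's assembly decl
`Summit.BirchSwinnertonDyer.BirchSwinnertonDyer.Theses.TameQuarticSolvent.Assembly`, i.e. the pure
bookkeeping implication
`PublishedInputGZK → SolventPairLowerBound → TprimeRankZeroUpperAtThree → TprimeRankOneUpperAtThree →
Summit.BirchSwinnertonDyer.WAllExclAddTprimeAtThreeRankOne`, by the route file's own kernel-checked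
deciding theorem `closes` (planner-authored, D-0027 §2.1). The three cruxes (`SolventPairLowerBound`,
`TprimeRankZeroUpperAtThree`, `TprimeRankOneUpperAtThree`) and the published input remain HYPOTHESES of the
implication: nothing here is progress on them, and BSD is not proved by any of this.
-/

-- D-0017: single-problem summit, so `Summit.BirchSwinnertonDyer.BirchSwinnertonDyer.…` repeats a namespace BY DESIGN.
set_option linter.dupNamespace false

namespace Summit.BirchSwinnertonDyer.BirchSwinnertonDyer.Theorems.TameQuarticSolvent

/-- **The assembly of route `TameQuarticSolvent`** (item stmt-BirchSwinnertonDyer-21394): the published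
input `PublishedInputGZK` (Gross–Zagier–Kolyvagin, by name) and the three cruxes `SolventPairLowerBound`,
`TprimeRankZeroUpperAtThree`, `TprimeRankOneUpperAtThree` imply the registered W-ALL leaf
`Summit.BirchSwinnertonDyer.WAllExclAddTprimeAtThreeRankOne` ((t′) at `3`, analytic rank one). This is
literally the route's deciding theorem `Theses.TameQuarticSolvent.closes` (the one-sided squeeze:
`SolventPairLowerBound` gives the pair `(E, E_d)` with `ord₃ q + ord₃ q′ ≤ ord₃ #Ш(E) + ord₃ #Ш(E_d)`, the
rank-zero upper half bounds `ord₃ #Ш(E_d) ≤ ord₃ q′`, subtraction gives the missing LOWER bound for `E`, the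
rank-one upper half gives the missing UPPER bound, and `Typed.bsdp_of_missingPPartAt` with GZK concludes
`BSDp E 3`). [father route-BirchSwinnertonDyer-TameQuarticSolvent, deciding theorem `closes`] -/
theorem assembly_proof :
    Summit.BirchSwinnertonDyer.BirchSwinnertonDyer.Theses.TameQuarticSolvent.Assembly := by
  unfold Summit.BirchSwinnertonDyer.BirchSwinnertonDyer.Theses.TameQuarticSolvent.Assembly
  intro hP hA hC hB
  exact Summit.BirchSwinnertonDyer.BirchSwinnertonDyer.Theses.TameQuarticSolvent.closes hP hA hC hB

end Summit.BirchSwinnertonDyer.BirchSwinnertonDyer.Theorems.TameQuarticSolvent
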